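import Mathlib

/-!
# Lever lemmas II for `OrbitClusterBound` — Taylor rows, monomial bases, heights and ideal norms, discriminants

Line `orbit-interpolation-determinant` for the crux `ApproximationProperty` (stmt-Schanuel-6117, route
DiophantineDichotomy), stub `stub_orbitClusterBound` (the lever, proved in
`DiophantineDichotomyApproximationPropertyOrbitClusterBound.lean`, which imports this file).
Everything here is PROVED; no definitions, no named facts.

* `prod_pow_eq_sum_box` and the two bounds `norm_prod_sub_pow_le`, `norm_prod_choose_mul_pow_le`:
  the multi-binomial expansion `∏ₗ zₗ^{aₗ} = ∑_{γ ∈ [0,δ]ᵗ} (∏ₗ (zₗ − xₗ)^{γₗ})(∏ₗ C(aₗ,γₗ) xₗ^{aₗ−γₗ})`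
  about a centre `x` and the sizes `r^{|γ|}`, `((2+‖x‖)²)^δ` of its two factors.
* `exists_monomial_basis`: if every element of a number field `K` is `Q(β)` with `deg Q ≤ δ`, then
  `K` has a `ℚ`-basis of monomials `β^α`, `|α| ≤ δ`, indexed by any type of cardinality `[K:ℚ]`.
* `absNorm_mul_mulHeight_eq_prod_embeddings`: for a non-zero tuple `x` of algebraic integers
  generating the ideal `𝔞`, `N(𝔞) · H_K(x) = ∏_{φ : K → ℂ} maxᵢ |φ(xᵢ)|` (the finite part of the
  height is `N(𝔞)⁻¹`: Mathlib `NumberField.absNorm_mul_finprod_finitePlace_eq_one`).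
* `absNorm_sq_le_abs_discr`, `absNorm_le_norm_det_embeddings`: if `[K:ℚ]` elements `y` of `K` lie in
  a fractional ideal `I` and are `ℚ`-linearly independent then `N(I)² ≤ |discr_ℚ(y)| = |det(σᵢ(yⱼ))|²`
  (`y = P · b_I` with `P` integral, `discr(b_I) = N(I)² d_K`, `det(P)², |d_K| ≥ 1`) — the
  ARITHMETIC lower bound for the interpolation determinant, with no loss of a factor `[K:ℚ]`
  (cf. TRIAGE-r1-1 on the card: a crude common denominator would lose it).
-/

open Finset Matrix NumberField Module Height
open scoped nonZeroDivisors

-- `Summit.Schanuel.Schanuel.…` is the mandated summit/sub-problem namespace (single-conjunct summit):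
set_option linter.dupNamespace false

namespace Summit.Schanuel.Schanuel.Cruxes.ApproximationProperty.OrbitInterpolationDeterminant


/-- One-variable binomial expansion about `x`, summed over the fixed range `[0, δ]`. -/
theorem pow_eq_sum_range_sub_pow (z x : ℂ) {a δ : ℕ} (ha : a ≤ δ) :
    z ^ a = ∑ i ∈ range (δ + 1), (z - x) ^ i * ((a.choose i : ℂ) * x ^ (a - i)) := by
  have h := add_pow (z - x) x a
  rw [sub_add_cancel] at h
  rw [h]
  have hsplit := Finset.sum_range_add_sum_Ico
    (fun i => (z - x) ^ i * ((a.choose i : ℂ) * x ^ (a - i))) (Nat.add_le_add_right ha 1)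
  rw [← hsplit]
  have hzero : ∑ i ∈ Ico (a + 1) (δ + 1), (z - x) ^ i * ((a.choose i : ℂ) * x ^ (a - i)) = 0 := by
    refine sum_eq_zero fun i hi => ?_
    rw [mem_Ico] at hi
    rw [Nat.choose_eq_zero_of_lt (by omega)]
    simp
  rw [hzero, add_zero]
  exact sum_congr rfl fun i _ => by ring

/-- **Multi-binomial expansion** of `∏ₗ zₗ^{aₗ}` about `x` over the box `[0, δ]ᵗ`. -/
theorem prod_pow_eq_sum_box : ∀ {t δ : ℕ} (z x : Fin t → ℂ) (a : Fin t → ℕ), (∀ l, a l ≤ δ) → ∏ l, z l ^ a l = ∑ γ ∈ Fintype.piFinset (fun _ : Fin t => Finset.range (δ + 1)), (∏ l, (z l - x l) ^ γ l) * ∏ l, ((Nat.choose (a l) (γ l) : ℂ) * x l ^ (a l - γ l)) := by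
  intro t δ z x a ha
  have h1 : ∏ l, z l ^ a l =
      ∏ l, ∑ i ∈ range (δ + 1), (z l - x l) ^ i * (((a l).choose i : ℂ) * x l ^ (a l - i)) :=
    prod_congr rfl fun l _ => pow_eq_sum_range_sub_pow (z l) (x l) (ha l)
  rw [h1, prod_univ_sum]
  exact sum_congr rfl fun γ _ => by rw [prod_mul_distrib]

/-- `‖∏ₗ (zₗ − xₗ)^{γₗ}‖ ≤ r^{|γ|}` when `‖z − x‖ ≤ r`. -/
theorem norm_prod_sub_pow_le {t : ℕ} (z x : Fin t → ℂ) (γ : Fin t → ℕ) {r : ℝ}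
    (h : ‖z - x‖ ≤ r) : ‖∏ l, (z l - x l) ^ γ l‖ ≤ r ^ ∑ l, γ l := by
  rw [norm_prod, ← prod_pow_eq_pow_sum]
  refine prod_le_prod (fun l _ => norm_nonneg _) fun l _ => ?_
  rw [norm_pow]
  refine pow_le_pow_left₀ (norm_nonneg _) ?_ _
  calc ‖z l - x l‖ = ‖(z - x) l‖ := rfl
    _ ≤ ‖z - x‖ := norm_le_pi_norm _ l
    _ ≤ r := h

/-- `‖∏ₗ C(aₗ,γₗ) xₗ^{aₗ−γₗ}‖ ≤ ((2+‖x‖)²)^δ` when `|a| ≤ δ`. -/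
theorem norm_prod_choose_mul_pow_le {t δ : ℕ} (x : Fin t → ℂ) (a γ : Fin t → ℕ)
    (ha : ∑ l, a l ≤ δ) :
    ‖∏ l, ((Nat.choose (a l) (γ l) : ℂ) * x l ^ (a l - γ l))‖ ≤ ((2 + ‖x‖) ^ 2) ^ δ := by
  set M : ℝ := max 1 ‖x‖ with hM
  have hM1 : 1 ≤ M := le_max_left _ _
  have hM0 : 0 ≤ M := zero_le_one.trans hM1
  have hstep : ∀ l, ‖((Nat.choose (a l) (γ l) : ℂ) * x l ^ (a l - γ l))‖ ≤ (2 * M) ^ a l := by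
    intro l
    rw [norm_mul, norm_pow, Complex.norm_natCast, mul_pow]
    refine mul_le_mul ?_ ?_ (by positivity) (by positivity)
    · exact_mod_cast (Nat.choose_le_two_pow (a l) (γ l))
    · calc ‖x l‖ ^ (a l - γ l) ≤ M ^ (a l - γ l) := by
            refine pow_le_pow_left₀ (norm_nonneg _) ?_ _
            exact (norm_le_pi_norm x l).trans (le_max_right _ _)
        _ ≤ M ^ a l := pow_le_pow_right₀ hM1 (Nat.sub_le _ _)
  calc ‖∏ l, ((Nat.choose (a l) (γ l) : ℂ) * x l ^ (a l - γ l))‖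
      = ∏ l, ‖((Nat.choose (a l) (γ l) : ℂ) * x l ^ (a l - γ l))‖ := norm_prod _ _
    _ ≤ ∏ l, (2 * M) ^ a l := prod_le_prod (fun l _ => norm_nonneg _) fun l _ => hstep l
    _ = (2 * M) ^ ∑ l, a l := prod_pow_eq_pow_sum _ _ _
    _ ≤ (2 * M) ^ δ := pow_le_pow_right₀ (by linarith) ha
    _ ≤ ((2 + ‖x‖) ^ 2) ^ δ := by
        refine pow_le_pow_left₀ (by positivity) ?_ _
        rcases le_total ‖x‖ 1 with hx | hx
        · rw [hM, max_eq_left hx]; nlinarith [norm_nonneg x]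
        · rw [hM, max_eq_right hx]; nlinarith [norm_nonneg x]



/-- The monomial `β^α = ∏ₗ βₗ^{αₗ}`. -/
theorem aeval_eq_sum_monomials {K : Type*} [Field K] [Algebra ℚ K] {t : ℕ} (β : Fin t → K)
    (Q : MvPolynomial (Fin t) ℚ) :
    MvPolynomial.aeval β Q = ∑ d ∈ Q.support, Q.coeff d • ∏ l, β l ^ d l := by
  conv_lhs => rw [MvPolynomial.as_sum Q]
  rw [map_sum]
  refine sum_congr rfl fun d _ => ?_
  rw [MvPolynomial.aeval_monomial, Algebra.smul_def]
  congr 1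
  rw [Finsupp.prod_fintype]
  intro l; simp

/-- **Monomial basis.** From the spanning hypothesis, a `ℚ`-basis of `K` of monomials of total
degree `≤ δ`, indexed by a given finite type `ι` with `#ι = [K:ℚ]`: exponents `α : ι → (Fin t → ℕ)`
with `∑ₗ α j l ≤ δ` and `j ↦ β^{α j}` linearly independent (hence a basis). -/
theorem exists_monomial_basis {K : Type*} [Field K] [NumberField K] {t δ : ℕ} (β : Fin t → K)
    (hspan : ∀ z : K, ∃ Q : MvPolynomial (Fin t) ℚ, Q.totalDegree ≤ δ ∧ MvPolynomial.aeval β Q = z)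
    (ι : Type*) [Fintype ι] (hι : Fintype.card ι = finrank ℚ K) :
    ∃ α : ι → (Fin t → ℕ), (∀ j, ∑ l, α j l ≤ δ) ∧
      LinearIndependent ℚ (fun j => ∏ l, β l ^ α j l) := by
  classical
  -- the monomials of degree ≤ δ span K
  set Λ : Set (Fin t → ℕ) := {a | ∑ l, a l ≤ δ} with hΛ
  set mono : (Fin t → ℕ) → K := fun a => ∏ l, β l ^ a l with hmono
  have hspan' : Submodule.span ℚ (mono '' Λ) = ⊤ := by
    rw [eq_top_iff]
    intro z _
    obtain ⟨Q, hQ, rfl⟩ := hspan z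
    rw [aeval_eq_sum_monomials]
    refine Submodule.sum_mem _ fun d hd => Submodule.smul_mem _ _ (Submodule.subset_span ?_)
    refine ⟨fun l => d l, ?_, rfl⟩
    show ∑ l, d l ≤ δ
    have h1 : (d.sum fun _ e => e) ≤ Q.totalDegree := MvPolynomial.le_totalDegree hd
    have h2 : (d.sum fun _ e => e) = ∑ l, d l := by
      rw [Finsupp.sum_fintype]; intro; rfl
    omega
  -- extract a linearly independent spanning subset
  obtain ⟨b, hbΛ, hbspan, hbli⟩ := exists_linearIndependent ℚ (mono '' Λ)
  rw [hspan'] at hbspan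
  have hbfin : b.Finite := LinearIndependent.setFinite (b := b) hbli
  haveI : Fintype b := hbfin.fintype
  let B : Basis b ℚ K := Basis.mk hbli (by rw [Subtype.range_coe_subtype, Set.setOf_mem_eq, hbspan])
  have hcard : Fintype.card b = Fintype.card ι := by
    rw [hι, finrank_eq_card_basis B]
  let e : ι ≃ b := (Fintype.equivOfCardEq hcard).symm
  -- choose exponents
  have hex : ∀ v : b, ∃ a : Fin t → ℕ, a ∈ Λ ∧ mono a = v := fun v => by
    obtain ⟨a, ha, hav⟩ := hbΛ v.2
    exact ⟨a, ha, hav⟩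
  choose a ha hav using hex
  refine ⟨fun j => a (e j), fun j => (ha (e j)), ?_⟩
  have hfun : (fun j => ∏ l, β l ^ a (e j) l) = (fun v : b => (v : K)) ∘ e := by
    funext j
    simp only [Function.comp_apply]
    rw [← hav (e j)]
  rw [hfun]
  exact hbli.comp _ e.injective




/-- Products over complex embeddings are products over infinite places with multiplicities. -/
theorem prod_embeddings_eq_prod_infinitePlace_pow {K : Type*} [Field K] [NumberField K]
    (f : InfinitePlace K → ℝ) :
    ∏ φ : K →+* ℂ, f (InfinitePlace.mk φ) = ∏ v : InfinitePlace K, f v ^ v.mult := by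
  classical
  rw [← Finset.prod_fiberwise Finset.univ InfinitePlace.mk (fun φ => f (InfinitePlace.mk φ))]
  refine Finset.prod_congr rfl fun w _ => ?_
  have h : ∀ φ ∈ ({φ | InfinitePlace.mk φ = w} : Finset (K →+* ℂ)),
      f (InfinitePlace.mk φ) = f w := fun φ hφ => by rw [(Finset.mem_filter.mp hφ).2]
  rw [Finset.prod_congr rfl h, Finset.prod_const, InfinitePlace.card_filter_mk_eq]

/-- **`N(𝔞) · H_K(x) = ∏_φ maxᵢ |φ(xᵢ)|`** for a non-zero tuple of algebraic integers `x`
generating the ideal `𝔞`. -/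
theorem absNorm_mul_mulHeight_eq_prod_embeddings {K : Type*} [Field K] [NumberField K]
    {ι : Type*} [Fintype ι] [Nonempty ι]
    (x : ι → 𝓞 K) (hx : x ≠ 0) :
    (Ideal.absNorm (Ideal.span (Set.range x)) : ℝ) * mulHeight (fun i => (x i : K)) =
      ∏ φ : K →+* ℂ, ⨆ i, ‖φ (x i)‖ := by
  have hxK : (fun i => (x i : K)) ≠ 0 := by
    intro h
    apply hx
    funext i
    have := congrFun h i
    simp only [Pi.zero_apply] at this ⊢
    exact_mod_cast this
  rw [NumberField.mulHeight_eq hxK]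
  have hfin := NumberField.absNorm_mul_finprod_finitePlace_eq_one (K := K) (x := x) hx
  have harch : (∏ v : InfinitePlace K, (⨆ i, v (x i : K)) ^ v.mult) =
      ∏ φ : K →+* ℂ, ⨆ i, ‖φ (x i)‖ := by
    rw [← prod_embeddings_eq_prod_infinitePlace_pow (fun v : InfinitePlace K => ⨆ i, v (x i : K))]
    simp only [InfinitePlace.apply]
  calc (Ideal.absNorm (Ideal.span (Set.range x)) : ℝ) *
        ((∏ v : InfinitePlace K, (⨆ i, v (x i : K)) ^ v.mult) *
          ∏ᶠ v : FinitePlace K, ⨆ i, v (x i : K))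
      = (∏ v : InfinitePlace K, (⨆ i, v (x i : K)) ^ v.mult) *
          ((Ideal.absNorm (Ideal.span (Set.range x)) : ℝ) *
            ∏ᶠ v : FinitePlace K, ⨆ i, v (x i : K)) := by ring
    _ = ∏ φ : K →+* ℂ, ⨆ i, ‖φ (x i)‖ := by rw [hfin, mul_one, harch]




/-- **`N(I)² ≤ |discr_ℚ(y)|`** for a `ℚ`-linearly independent family `y` of `[K:ℚ]` elements of
the fractional ideal `I` (indexed by the integral-basis index type). -/
theorem absNorm_sq_le_abs_discr {K : Type*} [Field K] [NumberField K]
    (I : (FractionalIdeal (𝓞 K)⁰ K)ˣ)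
    (y : Free.ChooseBasisIndex ℤ (𝓞 K) → K) (hy : ∀ j, y j ∈ (I : FractionalIdeal (𝓞 K)⁰ K))
    (hli : LinearIndependent ℚ y) :
    ((FractionalIdeal.absNorm (I : FractionalIdeal (𝓞 K)⁰ K) : ℚ)) ^ 2 ≤ |Algebra.discr ℚ y| := by
  classical
  -- index bookkeeping
  let e : (Free.ChooseBasisIndex ℤ (𝓞 K)) ≃ (Free.ChooseBasisIndex ℤ I) := by
    refine Fintype.equivOfCardEq ?_
    rw [← finrank_eq_card_chooseBasisIndex, ← finrank_eq_card_chooseBasisIndex,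
      fractionalIdeal_rank]
  set bI : Basis (Free.ChooseBasisIndex ℤ (𝓞 K)) ℚ K := (basisOfFractionalIdeal K I).reindex e.symm
    with hbI
  -- integer coordinates of `y` in `bI`
  have hcoord : ∀ j, ∃ c : Free.ChooseBasisIndex ℤ (𝓞 K) → ℤ, ∑ i, c i • bI i = y j := by
    intro j
    have hmem : y j ∈ Submodule.span ℤ (Set.range (basisOfFractionalIdeal K I)) :=
      (mem_span_basisOfFractionalIdeal K).mpr (hy j)
    have hrange : Set.range bI = Set.range (basisOfFractionalIdeal K I) := by
      rw [hbI, Basis.coe_reindex, Equiv.symm_symm, Set.range_comp, Equiv.range_eq_univ,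
        Set.image_univ]
    rw [← hrange] at hmem
    exact (Submodule.mem_span_range_iff_exists_fun ℤ).mp hmem
  choose c hc using hcoord
  let P : Matrix (Free.ChooseBasisIndex ℤ (𝓞 K)) (Free.ChooseBasisIndex ℤ (𝓞 K)) ℤ :=
    Matrix.of fun j i => c j i
  have hyP : y = (P.map (algebraMap ℤ ℚ)).map (algebraMap ℚ K) *ᵥ bI := by
    funext j
    rw [← hc j]
    simp only [mulVec, dotProduct, Matrix.map_apply, Matrix.of_apply, P, algebraMap_int_eq,
      eq_intCast, eq_ratCast, Rat.cast_intCast]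
    refine Finset.sum_congr rfl fun i _ => ?_
    rw [zsmul_eq_mul]
  -- discr(y) = det(P)² discr(bI)
  have h1 : Algebra.discr ℚ y = ((P.map (algebraMap ℤ ℚ)).det) ^ 2 * Algebra.discr ℚ bI := by
    rw [hyP, Algebra.discr_of_matrix_mulVec]
  have hdetP : (P.map (algebraMap ℤ ℚ)).det = (P.det : ℚ) := by
    rw [algebraMap_int_eq]
    have h := RingHom.map_det (Int.castRingHom ℚ) P
    rw [RingHom.mapMatrix_apply, eq_intCast] at h
    exact h.symm
  -- discr(bI) = (iB.det bI)² discr(iB), |iB.det bI| = N(I)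
  set iB := integralBasis K with hiB
  have h2 : Algebra.discr ℚ bI = (iB.det bI) ^ 2 * Algebra.discr ℚ iB := by
    have h := Algebra.discr_of_matrix_vecMul (⇑iB) (iB.toMatrix bI)
    rw [Basis.toMatrix_map_vecMul] at h
    rw [h, Basis.det_apply]
  have h3 : |iB.det bI| = FractionalIdeal.absNorm (I : FractionalIdeal (𝓞 K)⁰ K) := by
    rw [hbI, hiB]
    exact det_basisOfFractionalIdeal_eq_absNorm K I e
  -- nonvanishing
  have hcard : Fintype.card (Free.ChooseBasisIndex ℤ (𝓞 K)) = Module.finrank ℚ K := by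
    rw [← finrank_eq_card_chooseBasisIndex, RingOfIntegers.rank]
  have hyb : Algebra.discr ℚ y ≠ 0 := by
    let b : Basis (Free.ChooseBasisIndex ℤ (𝓞 K)) ℚ K :=
      basisOfLinearIndependentOfCardEqFinrank hli hcard
    have hb : (⇑b : _ → K) = y := by
      simp [b]
    rw [← hb]
    exact Algebra.discr_not_zero_of_basis ℚ b
  have hdK : (1 : ℚ) ≤ |Algebra.discr ℚ iB| := by
    rw [hiB, ← coe_discr, ← Int.cast_abs, ← Int.cast_one, Int.cast_le]
    exact Int.one_le_abs (discr_ne_zero K)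
  have hP1 : (1 : ℚ) ≤ ((P.det : ℤ) : ℚ) ^ 2 := by
    have hne : P.det ≠ 0 := by
      intro h0
      apply hyb
      rw [h1, hdetP, h0]; simp
    rw [← Int.cast_pow, ← Int.cast_one, Int.cast_le]
    nlinarith [Int.one_le_abs hne, sq_abs (P.det)]
  -- assemble
  rw [h1, hdetP, h2, abs_mul, abs_mul, abs_pow, abs_pow, h3]
  have hN : 0 ≤ (FractionalIdeal.absNorm (I : FractionalIdeal (𝓞 K)⁰ K) : ℚ) :=
    FractionalIdeal.absNorm_nonneg _
  calc (FractionalIdeal.absNorm (I : FractionalIdeal (𝓞 K)⁰ K) : ℚ) ^ 2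
      = 1 * ((FractionalIdeal.absNorm (I : FractionalIdeal (𝓞 K)⁰ K) : ℚ) ^ 2 * 1) := by ring
    _ ≤ |((P.det : ℤ) : ℚ)| ^ 2 *
          ((FractionalIdeal.absNorm (I : FractionalIdeal (𝓞 K)⁰ K) : ℚ) ^ 2 * |Algebra.discr ℚ iB|) := by
        have : |((P.det : ℤ) : ℚ)| ^ 2 = ((P.det : ℤ) : ℚ) ^ 2 := sq_abs _
        rw [this]
        gcongr

/-- **Embedding form**: with `e : ι₀ ≃ (K →ₐ[ℚ] ℂ)`, `N(I)² ≤ ‖det (σ_{e a}(y j))‖²`. -/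
theorem absNorm_le_norm_det_embeddings {K : Type*} [Field K] [NumberField K]
    (I : (FractionalIdeal (𝓞 K)⁰ K)ˣ)
    (y : Free.ChooseBasisIndex ℤ (𝓞 K) → K) (hy : ∀ j, y j ∈ (I : FractionalIdeal (𝓞 K)⁰ K))
    (hli : LinearIndependent ℚ y) (e : Free.ChooseBasisIndex ℤ (𝓞 K) ≃ (K →ₐ[ℚ] ℂ)) :
    (FractionalIdeal.absNorm (I : FractionalIdeal (𝓞 K)⁰ K) : ℝ) ≤
      ‖(Matrix.of fun a j => e a (y j) : Matrix _ _ ℂ).det‖ := by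
  classical
  have h := absNorm_sq_le_abs_discr I y hy hli
  have hemb := Algebra.discr_eq_det_embeddingsMatrixReindex_pow_two ℚ ℂ y e
  -- the matrix `of (a, j) ↦ e a (y j)` is the transpose of `embeddingsMatrixReindex`
  have hT : (Matrix.of fun a j => e a (y j) : Matrix _ _ ℂ) =
      (Algebra.embeddingsMatrixReindex ℚ ℂ y e)ᵀ := by
    ext a j
    simp [Algebra.embeddingsMatrixReindex, Algebra.embeddingsMatrix]
  rw [hT, det_transpose]
  have hnorm : ‖(Algebra.embeddingsMatrixReindex ℚ ℂ y e).det‖ ^ 2 = |(Algebra.discr ℚ y : ℝ)| := by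
    rw [← norm_pow, ← hemb]
    simp only [eq_ratCast, Complex.norm_ratCast]
  have hsq : (FractionalIdeal.absNorm (I : FractionalIdeal (𝓞 K)⁰ K) : ℝ) ^ 2 ≤
      ‖(Algebra.embeddingsMatrixReindex ℚ ℂ y e).det‖ ^ 2 := by
    rw [hnorm]
    have := h
    exact_mod_cast this
  have hN0 : 0 ≤ (FractionalIdeal.absNorm (I : FractionalIdeal (𝓞 K)⁰ K) : ℝ) := by
    exact_mod_cast FractionalIdeal.absNorm_nonneg _
  exact (pow_le_pow_iff_left₀ hN0 (norm_nonneg _) two_ne_zero).mp hsq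


end Summit.Schanuel.Schanuel.Cruxes.ApproximationProperty.OrbitInterpolationDeterminant
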